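import Summits.QuantumFields.YangMills.Theorems.BalabanUVNodesN11BgRowGaugeSocketsGB
import Summits.QuantumFields.YangMills.Theorems.BalabanUVNodesN07RecordDomainsAdm22
import Literature.MathematicalPhysics.QuantumFieldTheory.Balaban1983to89.Node00.CriticalOnFibreTopGuardedBPrint

/-!
# DAG node N11 × K1 — PRINT'S (7) DATA CLAUSE ON THE GUARD-FREE ROW P11 ROAD: at a power-of-`L` basic cube the regions `Ω_j(s)` of EVERY (2.18) index of EVERY run are block-saturated
# (compatible-or-one-block dichotomy), so the support's (b) clause `Sect2.DataSmall7PTop` TRANSFERS to print's `dataSmall7LamTopOf` on every window run — the `hDat` hypothesis of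
# `…N11BgRowGaugeSocketsGB` DISCHARGED at `Dat := dataSmall7LamTopOf F N`, no run guard

HEADER — WORK-UNIT METADATA.  Cell `pub-ymgap`, YM-PLAN Track A (D-0062 ∕ D-0149 ∕ D-0154 width seats), seat `pub-ymgap-dag-n11-w1` (g6; WIDTH SEAT 1 on NODE n11 [B14]; Stage-2 train
WORKPLAN-IIIB (iii-b), director-ym №343 ∕ №346 (3) ∕ №348 (C) ∕ №359; follow-up to this seat's `…N11BgRowGaugeSocketsGB` ✓p767538 and its LOCATED note, cell INBOX 09:00:29Z ∕ 09:17:02Z),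
route `BalabanUVNodes`, key `--kind proof --supports stmt-QuantumFields-20541 --as helper` (K0⁷ helper lane, count-neutral).  [III] = [Balaban1988Convergent], [I] = [Balaban1987RG1],
[15] = [Balaban1985Variational], [6] = [Balaban1985RegularSpaces], [II] = [Balaban1984PropagatorsII], [IV] = [Balaban1989LargeFieldI].  Over this seat's `…N11BgRowGaugeSocketsGB` (§1b ∕ §2b ∕ §3b:
the `BgProvisoΛ` sockets with `hDat` displayed), dag-n11-w4 ∕ -w5's `…N11OneBlockLevels` (★★ `dCubeSide_dvd_or_lt`, ★ `eq_empty_or_eq_univ_of_mem_unionsOfCubes_of_le` — the compatible-or-one-block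
dichotomy at `τ9.M = L^a`), dag-n07's `…N07RecordDomainsAdm22` (`blockSat_of_fineSat`, `fineSat_of_mem_unionsOfCubes`, `pow_mul_dvd_dCubeSide`) and n07-e's P0 `Node00/CriticalOnFibreTopGuardedBPrint`
(`dataSmall7LamTopOf_of_seq` = def-Y §7′ `Sect2.DataSmall7PTop.toLamTop` at a (2.18) index).

WHY THIS FILE.  `…SocketsGB` displays the (7) data transfer `hDat : Sect2.DataSmall7PTop … → Dat …` because the transfer to PRINT's clause (`Sect2.DataSmall7PTop.toLamTop`) needs the block
saturation `hsat` of the regions `Ω_j(s)`, which the tree had only from the grid compatibility `PartCompat₁₃` (`blockSat_seqOfRecord`'s `hdiv`) — absent on this road by design.  But at a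
power-of-`L` basic cube `θ.τ9.M = L^a` every `𝐃_j`-cube side of record is a power of `L` ([III] (2.5): `R_j = L^{s_j}`), hence EITHER divides the torus period `2L^{m+K}` (compatible: K0b ∕
dag-n07's nested-grid saturation) OR exceeds it (one block: `Ω_j(s) ∈ {∅, 𝕋}`, saturated trivially) — `…N11OneBlockLevels`' dichotomy, the same device that freed `hcubeΩ` (dag-n11-w4's
`hcubeΩ_of_powM`).  So `hsat` holds for EVERY (2.18) index of EVERY run, with NO run guard and NO (C1), and print's (7) clause is served on the whole window: this seat's LOCATED note of 09:00Z
(«not available below the coupling floor») is hereby CORRECTED — it IS available; only the d-cube-divisibility GUARDS (a supplier's `Adm` choice) remain outside the road.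

WHAT THIS FILE PROVES (6 theorems, 0 `def`, 0 `sorry`; elementary compositions; every [15] sentence, `hseam`, `hadm` remain HYPOTHESES).
§1 ★★ `blockSat_seqOfRecord_of_dvd_or_le` (any `(ν, M, g, K, k)`, `k ≤ m + K`: block saturation of `s.Ω j`, `1 ≤ j ≤ k`, from the per-level dichotomy «`𝐃_j`-side ∣ period ∨ period ≤
   `𝐃_j`-side») · ★★ `blockSat_seqOfRecord₁₃_of_powM` (Stage 13, `θ.τ9.M = L^a`, any run `p`, any `n ≤ p.K`: the dichotomy DISCHARGED by `dCubeSide_dvd_or_lt`).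
§2 ★★★ `dataSmall7LamTopOf_of_dataSmall7PTop_of_powM` — THE `hDat` OF `…SocketsGB` AT `Dat := dataSmall7LamTopOf F N`, on every run `(p, n ≤ p.K)` (the window antecedent kept for the
   shape, unused): `Sect2.DataSmall7PTop (avOfRecord F N p.K) s.Ω (suppDomOfRecord …) n δ W → dataSmall7LamTopOf F N p.K s.Ω (suppDomOfRecord …) n δ W`.
§3 ★★★ `bgProvisoΛ_of_thm1RegSepCoP7MGB_of_thm1GaugeGB_of_hseam_of_powM_lamTop` ∕ ★★★ `bgProvisoΛ_theta13OfThm1CCMW_…_of_hseam_of_hjm_lamTop` ∕ ★★★ `bgProvisoΛ_theta13OfThm1CCMWZ_…_lamTop` —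
   `…SocketsGB` §1b ∕ §2b ∕ §3b over the ᴮ sentences AT PRINT'S DATA CLAUSE `(bd, dataSmall7LamTopOf F N)` with `hDat` DISCHARGED: row P11 `BgProvisoΛ … (suppOfRecord₁₃SepCoP …)
   (UbgOfRecord₁₃CoP …)` on every window run, θ-generic ∕ at θ₁₅ᶜᶜᴹᵂ(j; γ) ∕ at θ₁₅ᶜᶜᴹᵂᶻ(j; γ; Efl, logz), background still a parameter (`Ubg`, `hbg`, `hseam`), guard still `hadm`.

HONEST FRAMING.  Helper lane (K0⁷ key; N11 [B14] × K1 road); count-neutral; §1–§2 are elementary torus∕grid bookkeeping (no analysis), §3 hypothesis threading; the ᴮ [15] sentences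
(8)∕(9) are `Prop`s with parameters, NEVER asserted; `hseam` NOT provable at the ᴮ background before node00-def-R's seam edit and NOT claimed; `hadm`, (hcomp) ∧ (hcompRev), window,
signs, `hjm` DISPLAYED.  Nothing in the tree is edited.  NOT a discharge of row P11; N11 ∕ N07 NOT discharged; K0⁷ stub 1 NOT closed; counts unmoved (typed 28∕28 · discharged 8∕27).
R4 closes only the conditional finite-𝕋⁴ rung `BalabanLadder.UV` at fixed `ε = L^{−K}` — NOT ℝ⁴, NOT OS, NOT a mass gap; the Yang–Mills mass gap (Clay) is NOT proved by any of this.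
No `sorry`, `axiom`, `def`, `instance`, `notation`.
Sources (SHAPE ∕ bookkeeping only): [III] (2.1) p.254, (2.5) p.255, (2.12)–(2.13) p.256, (2.17)–(2.18) p.257, (2.28) p.259, Thm 1 p.262; [I] (0.1)–(0.3) pp.251–252; [15] (3),(6)–(7)
p.278, Thm 1 (8)–(9) p.279, Prop. 8 p.304; [6] (1.3)–(1.6) p.77; [II] (2.1)–(2.3) p.224; [IV] (0.3) p.176.
-/

noncomputable section

open MeasureTheory
open scoped Matrix.Norms.L2Operator

namespace Summit.QuantumFields.YangMills.Theorems.BalabanUVNodesN11BgRowGaugeSocketsGBPrint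

open Literature.MathematicalPhysics.QuantumFieldTheory.Balaban1983to89 Node00
open T4Continuum B14.Eq218Concrete B15DeterminingSets B15DeterminingSetsB FlowStep FlowStepRuns B12RegularSpaces111 B14RegularSpaces234 B14Radii T4AxialGaugeSmallField
open B5Eq118OneStroke (iterBlockOf)
open Summit.QuantumFields.YangMills.BalabanUVNodes.N07RecordDomainsAdm22 (blockSat_of_fineSat fineSat_of_mem_unionsOfCubes pow_mul_dvd_dCubeSide)
open BalabanUVNodesN11OneBlockLevels (dCubeSide_dvd_or_lt eq_empty_or_eq_univ_of_mem_unionsOfCubes_of_le)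
open BalabanUVNodesN11BgRowGaugeSocketsGB

variable {F : T4Family} {N : ℕ} [NeZero N]

/-! ## §1  Block saturation of the regions of record WITHOUT the run guard — compatible or one-block -/

section BlockSat

/-- **§1 ★★ BLOCK SATURATION OF `Ω_j(s)`, `1 ≤ j ≤ k`, FROM THE PER-LEVEL DICHOTOMY** «the `𝐃_j`-cube side of record divides the torus period, OR the period is at most that side»:
in the first case dag-n07 ∕ K0b's nested-grid label saturation (`fineSat_of_mem_unionsOfCubes`, `L^j ∣` the side), in the second `…N11OneBlockLevels`' `Ω_j(s) ∈ {∅, 𝕋}` — either way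
membership in `Ω_j(s)` depends only on the `j`-block (`blockSat_of_fineSat`).  = `blockSat_seqOfRecord` with its `hdiv` WEAKENED to the dichotomy.  Elementary bookkeeping.
[cite: Balaban1988Convergent, (2.1) p.254, (2.17)–(2.18) p.257, p.257 («compatible with all other partitions»); Balaban1987RG1, (0.1)–(0.3) pp.251–252; Balaban1984PropagatorsII, (2.1)–(2.2) p.224] -/
theorem blockSat_seqOfRecord_of_dvd_or_le (ν : Stage7Numerics) (M : ℕ) (g : ℕ → ℝ) (K k : ℕ) (hk : k ≤ (F.P K).m + (F.P K).K) (s : SeqOfRecord F ν M g K k)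
    (hdich : ∀ j, 1 ≤ j → j ≤ k → dCubeSide (F.P K).L M (RkOfRecord (F.P K).L ν.r (g j)) j ∣ (F.P K).sitesPerDir 0 ∨
      (F.P K).sitesPerDir 0 ≤ dCubeSide (F.P K).L M (RkOfRecord (F.P K).L ν.r (g j)) j) :
    ∀ (j : ℕ) (x x' : Site (F.P K) 0), 1 ≤ j → j ≤ k → iterBlockOf j x = iterBlockOf j x' → x ∈ s.Ω j → x' ∈ s.Ω j := by
  refine blockSat_of_fineSat (t := 1) hk fun j hj1 hjk x x' h hx => ?_
  rcases hdich j hj1 hjk with hdvd | hle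
  · exact fineSat_of_mem_unionsOfCubes (Nat.pos_of_dvd_of_pos hdvd (Nat.pos_of_ne_zero ((F.P K).sitesPerDir_ne_zero 0))) hdvd
      (pow_mul_dvd_dCubeSide j (one_dvd _)) (s.chain.memΩ j hj1 hjk) h hx
  · rcases eq_empty_or_eq_univ_of_mem_unionsOfCubes_of_le hle (s.chain.memΩ j hj1 hjk) with h0 | h1
    · rw [h0] at hx; exact (Set.notMem_empty x hx).elim
    · rw [h1]; exact Set.mem_univ x'

/-- **§1′ ★★ AT A POWER-OF-`L` BASIC CUBE THE REGIONS OF RECORD OF EVERY RUN ARE BLOCK-SATURATED — NO RUN GUARD** (Stage 13, `θ.τ9.M = F.L ^ a`, any run `p`, any `n ≤ p.K`): §1 with the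
dichotomy DISCHARGED by `…N11OneBlockLevels`' `dCubeSide_dvd_or_lt` ([III] (2.5): `R_j` is a power of `L`).  The `hsat` of `Sect2.DataSmall7PTop.toLamTop` ∕ `dataSmall7LamTopOf_of_seq` on this road.
[cite: Balaban1988Convergent, (2.1) p.254, (2.5) p.255, (2.17)–(2.18) p.257; Balaban1987RG1, (0.1) p.251] -/
theorem blockSat_seqOfRecord₁₃_of_powM (θ : Stage13Params F N) {a : ℕ} (hMa : θ.τ9.M = F.L ^ a) (p : B12.RunParams) {n : ℕ} (hn : n ≤ p.K)
    (s : SeqOfRecord F θ.ν θ.τ9.M (gOfRecord₁₃ F N θ p) p.K n) :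
    ∀ (j : ℕ) (x x' : Site (F.P p.K) 0), 1 ≤ j → j ≤ n → iterBlockOf j x = iterBlockOf j x' → x ∈ s.Ω j → x' ∈ s.Ω j :=
  blockSat_seqOfRecord_of_dvd_or_le θ.ν θ.τ9.M (gOfRecord₁₃ F N θ p) p.K n (hn.trans (Nat.le_add_left _ _)) s
    fun j _ _ => (dCubeSide_dvd_or_lt θ hMa p j).imp_right le_of_lt

end BlockSat

/-! ## §2  The (7) data transfer to PRINT's clause on every run — the `hDat` of `…SocketsGB` at `Dat := dataSmall7LamTopOf F N` -/

section Transfer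

/-- **§2 ★★★ PRINT'S (7) DATA CLAUSE FROM THE SUPPORT'S (b) CLAUSE ON EVERY RUN AT A POWER-OF-`L` BASIC CUBE — NO RUN GUARD**: for any admissible-or-not `θ` with `θ.τ9.M = F.L ^ a`, every
run `p`, every `n ≤ p.K`, every (2.18) index `s`, radii `δ`, data `𝐖`: `Sect2.DataSmall7PTop (avOfRecord F N p.K) s.Ω (suppDomOfRecord …) n δ 𝐖 → dataSmall7LamTopOf F N p.K s.Ω (suppDomOfRecord …) n δ 𝐖`
(n07-e's P0 `dataSmall7LamTopOf_of_seq` = def-Y §7′ `Sect2.DataSmall7PTop.toLamTop`, its `hsat` by §1′, its range letter `n ≤ m + K` from `n ≤ p.K`).  EXACTLY the displayed transfer `hDat` of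
`…N11BgRowGaugeSocketsGB` §1b ∕ §2b ∕ §3b at `Dat := dataSmall7LamTopOf F N` (the window antecedent is kept for that shape and not used).
[cite: Balaban1985Variational, (3),(7) p.278 L20–33; Balaban1984PropagatorsII, (2.3) p.224; Balaban1988Convergent, (2.1) p.254, (2.5) p.255, (2.10)–(2.12) p.256, (2.18) p.257] -/
theorem dataSmall7LamTopOf_of_dataSmall7PTop_of_powM (θ : Stage13Params F N) {a : ℕ} (hMa : θ.τ9.M = F.L ^ a) :
    ∀ (p : B12.RunParams) (n : ℕ) (s : SeqOfRecord F θ.ν θ.τ9.M (gOfRecord₁₃ F N θ p) p.K n) (δ : ℕ → ℝ) (W : MSField (F.P p.K) (SU N)),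
      n ≤ p.K → Step.InInterval θ.γ n (gOfRecord₁₃ F N θ p) →
      Sect2.DataSmall7PTop (avOfRecord F N p.K) s.Ω (suppDomOfRecord F θ.ν p.K s.Ω) n δ W → dataSmall7LamTopOf F N p.K s.Ω (suppDomOfRecord F θ.ν p.K s.Ω) n δ W :=
  fun p _ s _ _ hn _ h => dataSmall7LamTopOf_of_seq s (hn.trans (Nat.le_add_left _ _)) (blockSat_seqOfRecord₁₃_of_powM θ hMa p hn s) h

end Transfer

/-! ## §3  `…SocketsGB`'s `BgProvisoΛ` sockets AT PRINT'S DATA CLAUSE, `hDat` discharged -/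

section AtPrint

/-- **§3a ★★★ THE WITNESS-AGNOSTIC `BgProvisoΛ` SOCKET OVER THE ᴮ SENTENCES AT PRINT'S (7) DATA CLAUSE** (`…SocketsGB` §1b at `Dat := dataSmall7LamTopOf F N`, `hDat := §2`): for any admissible
`θ` with `θ.Rz = RzOfRecord`, `θ.τ9.M = L^a`, the window (C1) letter, `hsN`, the numeric rows, any guard met on the window prefixes, any background `(Ubg, bd)` with `hbg` ∧ `hseam`, and the ᴮ
sentences `VariationalThm1RegSepCoP7MGB F N Adm bd (dataSmall7LamTopOf F N)` ∕ `VariationalThm1GaugeRegSepCoP7MGB F N θ.τ9.M Adm bd (dataSmall7LamTopOf F N)` ([15] Thm 1 for `bd`-minimisers with data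
small in PRINT's sense (7)): row P11 `BgProvisoΛ … (suppOfRecord₁₃SepCoP …) (UbgOfRecord₁₃CoP …)` on EVERY window run — NO `PartCompat₁₃`.  CONDITIONAL; a REDUCTION; nothing of Bałaban asserted.
[cite: Balaban1985Variational, (3),(6)–(7) p.278, Thm 1 (8)–(9) p.279, Prop. 8 p.304, p.304 lines 1–2; Balaban1984PropagatorsII, (2.3) p.224; Balaban1985RegularSpaces, (1.3)–(1.9) p.77; Balaban1988Convergent, Thm 1 p.262, (2.1) p.254, (2.5) p.255, (2.12)–(2.13) p.256, (2.18) p.257, (2.27)–(2.28) p.259; Balaban1987RG1, (0.1) p.251, (1.11)–(1.12) p.262] -/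
theorem bgProvisoΛ_of_thm1RegSepCoP7MGB_of_thm1GaugeGB_of_hseam_of_powM_lamTop (θ : Stage13Params F N) (hθ : θ.Admissible F N) (hRz : θ.Rz = RzOfRecord F N)
    {Adm : StepGuard F} {bd : BondDatum F} {a : ℕ} {B₃ B₃' a₀ a₁ : ℝ}
    (h15 : VariationalThm1RegSepCoP7MGB F N Adm bd (dataSmall7LamTopOf F N) B₃ a₀ a₁) (h15G : VariationalThm1GaugeRegSepCoP7MGB F N θ.τ9.M Adm bd (dataSmall7LamTopOf F N) B₃ B₃' a₀ a₁)
    (Ubg : (p : B12.RunParams) → (n : ℕ) → SeqOfRecord F θ.ν θ.τ9.M (gOfRecord₁₃ F N θ p) p.K n → BgMap F N p.K)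
    (hbg : ∀ (p : B12.RunParams) (n : ℕ) (s : SeqOfRecord F θ.ν θ.τ9.M (gOfRecord₁₃ F N θ p) p.K n) (W : MSField (F.P p.K) (SU N)),
      IsMinimizerB (avOfRecord F N p.K) (regMSCoPOfRecord F N θ.ν p.K n s.Ω) (bd p.K n s.Ω) W (Ubg p n s W) ∨ Ubg p n s W = 1)
    (hseam : ∀ (p : B12.RunParams) (n : ℕ), UbgOfRecord₁₃CoP F N θ p (n + 1) = Ubg p (n + 1))
    (hnum : ∀ (p : B12.RunParams) (n : ℕ), n ≤ p.K → Step.InInterval θ.γ n (gOfRecord₁₃ F N θ p) → ∀ m, m ≤ n →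
      0 < θ.s2.cR * epsOfRecord θ.ν (gOfRecord₁₃ F N θ p) m ∧ θ.s2.cR * epsOfRecord θ.ν (gOfRecord₁₃ F N θ p) m ≤ a₁ ∧ B₃ * (θ.s2.cR * epsOfRecord θ.ν (gOfRecord₁₃ F N θ p) m) ≤ θ.ν.εreg)
    (ha₀ : θ.ν.εreg ≤ a₀)
    (hcomp : ∀ (p : B12.RunParams) (n : ℕ), n ≤ p.K → Step.InInterval θ.γ n (gOfRecord₁₃ F N θ p) → ∀ m, m < n →
      θ.s2.cR * epsOfRecord θ.ν (gOfRecord₁₃ F N θ p) m ≤ 2 * (θ.s2.cR * epsOfRecord θ.ν (gOfRecord₁₃ F N θ p) (m + 1)))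
    (hcomp' : ∀ (p : B12.RunParams) (n : ℕ), n ≤ p.K → Step.InInterval θ.γ n (gOfRecord₁₃ F N θ p) → ∀ m, m < n →
      θ.s2.cR * epsOfRecord θ.ν (gOfRecord₁₃ F N θ p) (m + 1) ≤ 2 * (θ.s2.cR * epsOfRecord θ.ν (gOfRecord₁₃ F N θ p) m))
    (hBα : ∀ (p : B12.RunParams) (n : ℕ), n ≤ p.K → Step.InInterval θ.γ n (gOfRecord₁₃ F N θ p) → ∀ m, 1 ≤ m → m ≤ n →
      B₃ * (θ.s2.cR * epsOfRecord θ.ν (gOfRecord₁₃ F N θ p) m) ≤ (1 - θ.s2.βc) * (lfOfRecord₁₂ F N θ.toStage12Params).alpha0 (gOfRecord₁₃ F N θ p m))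
    (htI : ∀ (p : B12.RunParams) (n : ℕ), n ≤ p.K → Step.InInterval θ.γ n (gOfRecord₁₃ F N θ p) → ∀ m, 1 ≤ m → m ≤ n →
      B₃' * (θ.s2.cR * epsOfRecord θ.ν (gOfRecord₁₃ F N θ p) m) ≤ θ.s2.cB * (lfOfRecord₁₂ F N θ.toStage12Params).alpha0 (gOfRecord₁₃ F N θ p m))
    (htMS : ∀ (p : B12.RunParams) (n : ℕ), n ≤ p.K → Step.InInterval θ.γ n (gOfRecord₁₃ F N θ p) → ∀ m, 1 ≤ m → m ≤ n →
      B₃' * (θ.s2.cR * epsOfRecord θ.ν (gOfRecord₁₃ F N θ p) m) ≤ θ.s2.B * θ.s2.C * θ.s2.Mr * (lfOfRecord₁₂ F N θ.toStage12Params).alpha0 (gOfRecord₁₃ F N θ p m))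
    (hsN : ∀ (p : B12.RunParams) (n : ℕ), n ≤ p.K → ∀ n', 1 ≤ n' → n' ≤ n + 1 →
      ((B14.Eq213MaximalDomains.side (F.P p.K).L θ.τ9.M n' : ℕ) : ℤ) < (F.P p.K).sitesPerDir 0)
    (hMa : θ.τ9.M = F.L ^ a)
    (hC1 : ∀ (p : B12.RunParams) (n : ℕ), n ≤ p.K → Step.InInterval θ.γ n (gOfRecord₁₃ F N θ p) → ∀ j, 1 ≤ j → j ≤ n →
      ∃ t : ℕ, 0 < t ∧ RkOfRecord (F.P p.K).L θ.ν.r (gOfRecord₁₃ F N θ p j) = (F.P p.K).L * t)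
    (hM₁ : 0 < θ.ν.M₁)
    (hadm : ∀ (p : B12.RunParams) (n : ℕ), n ≤ p.K → Step.InInterval θ.γ n (gOfRecord₁₃ F N θ p) →
      ∀ s : SeqOfRecord F θ.ν θ.τ9.M (gOfRecord₁₃ F N θ p) p.K n, Adm θ.ν θ.τ9.M (gOfRecord₁₃ F N θ p) p.K n s) :
    ∀ (p : B12.RunParams) (n : ℕ), n ≤ p.K → Step.InInterval θ.γ n (gOfRecord₁₃ F N θ p) →
      BgProvisoΛ F N p.K (settingOfRecord₁₃ F N θ p) (θ.Rz p.K) θ.τ9.M n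
        (suppOfRecord₁₃SepCoP F N θ p n) (UbgOfRecord₁₃CoP F N θ p n) :=
  bgProvisoΛ_of_thm1RegSepCoP7MGB_of_thm1GaugeGB_of_hseam_of_powM θ hθ hRz h15 h15G Ubg hbg hseam hnum ha₀ hcomp hcomp' hBα htI htMS hsN hMa hC1 hM₁ hadm
    (dataSmall7LamTopOf_of_dataSmall7PTop_of_powM θ hMa)

variable {j : ℕ} {γ ε₀ ε₂₉ B₃ B₃' a₀ a₁ : ℝ} {Efl logz : B12.RunParams → ℕ → ℝ}

/-- **§3b ★★★ ROW P11 `BgProvisoΛ` AT K1's WITNESS OF RECORD `θ₁₅ᶜᶜᴹᵂ(j; γ)` ON EVERY WINDOW RUN FROM THE ᴮ SENTENCES AT PRINT'S (7) DATA CLAUSE — `hDat` DISCHARGED** (`…SocketsGB` §2b at `Dat := dataSmall7LamTopOf F N`,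
`hDat := §2` with `τ9.M = L^j`): non-wrapping families `j + 1 ≤ F.m`, any guard met on the window prefixes, any background `(Ubg, bd)` with `hbg` ∧ `hseam`.  CONDITIONAL; nothing of Bałaban asserted.
[cite: Balaban1985Variational, (3),(6)–(7) p.278, Thm 1 (8)–(9) p.279, p.304 lines 1–2; Balaban1984PropagatorsII, (2.3) p.224; Balaban1985RegularSpaces, (1.3)–(1.6) p.77; Balaban1988Convergent, (2.28) p.259, (2.18) p.257, (2.5) p.255, Thm 1 p.262; Balaban1987RG1, (0.1) p.251, (1.12) p.262] -/
theorem bgProvisoΛ_theta13OfThm1CCMW_of_thm1RegSepCoP7MGB_of_thm1GaugeGB_of_hseam_of_hjm_lamTop (hγ0 : 0 < γ) (hγ : γ ≤ 1 / 2) (hjm : j + 1 ≤ F.m) (hε : 0 < ε₀) (hε' : 0 < ε₂₉) (hB : 0 ≤ B₃)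
    (hB' : 0 ≤ B₃') (ha₀ : 0 < a₀) (ha₁ : 0 < a₁) {Adm : StepGuard F} {bd : BondDatum F}
    (h15 : VariationalThm1RegSepCoP7MGB F N Adm bd (dataSmall7LamTopOf F N) B₃ a₀ a₁) (h15G : VariationalThm1GaugeRegSepCoP7MGB F N (F.L ^ j) Adm bd (dataSmall7LamTopOf F N) B₃ B₃' a₀ a₁)
    (Ubg : (p : B12.RunParams) → (n : ℕ) → SeqOfRecord F (theta13OfThm1CCMW F N j γ ε₀ ε₂₉ B₃ B₃' a₀ a₁).ν (theta13OfThm1CCMW F N j γ ε₀ ε₂₉ B₃ B₃' a₀ a₁).τ9.M (gOfRecord₁₃ F N (theta13OfThm1CCMW F N j γ ε₀ ε₂₉ B₃ B₃' a₀ a₁) p) p.K n → BgMap F N p.K)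
    (hbg : ∀ (p : B12.RunParams) (n : ℕ) (s : SeqOfRecord F (theta13OfThm1CCMW F N j γ ε₀ ε₂₉ B₃ B₃' a₀ a₁).ν (theta13OfThm1CCMW F N j γ ε₀ ε₂₉ B₃ B₃' a₀ a₁).τ9.M (gOfRecord₁₃ F N (theta13OfThm1CCMW F N j γ ε₀ ε₂₉ B₃ B₃' a₀ a₁) p) p.K n) (W : MSField (F.P p.K) (SU N)),
      IsMinimizerB (avOfRecord F N p.K) (regMSCoPOfRecord F N (theta13OfThm1CCMW F N j γ ε₀ ε₂₉ B₃ B₃' a₀ a₁).ν p.K n s.Ω) (bd p.K n s.Ω) W (Ubg p n s W) ∨ Ubg p n s W = 1)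
    (hseam : ∀ (p : B12.RunParams) (n : ℕ), UbgOfRecord₁₃CoP F N (theta13OfThm1CCMW F N j γ ε₀ ε₂₉ B₃ B₃' a₀ a₁) p (n + 1) = Ubg p (n + 1))
    (hadm : ∀ (p : B12.RunParams) (n : ℕ), n ≤ p.K → Step.InInterval (theta13OfThm1CCMW F N j γ ε₀ ε₂₉ B₃ B₃' a₀ a₁).γ n (gOfRecord₁₃ F N (theta13OfThm1CCMW F N j γ ε₀ ε₂₉ B₃ B₃' a₀ a₁) p) →
      ∀ s : SeqOfRecord F (theta13OfThm1CCMW F N j γ ε₀ ε₂₉ B₃ B₃' a₀ a₁).ν (theta13OfThm1CCMW F N j γ ε₀ ε₂₉ B₃ B₃' a₀ a₁).τ9.M (gOfRecord₁₃ F N (theta13OfThm1CCMW F N j γ ε₀ ε₂₉ B₃ B₃' a₀ a₁) p) p.K n, Adm (theta13OfThm1CCMW F N j γ ε₀ ε₂₉ B₃ B₃' a₀ a₁).ν (theta13OfThm1CCMW F N j γ ε₀ ε₂₉ B₃ B₃' a₀ a₁).τ9.M (gOfRecord₁₃ F N (theta13OfThm1CCMW F N j γ ε₀ ε₂₉ B₃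 B₃' a₀ a₁) p) p.K n s)
    (hcomp : ∀ (p : B12.RunParams) (n : ℕ), n ≤ p.K → Step.InInterval (theta13OfThm1CCMW F N j γ ε₀ ε₂₉ B₃ B₃' a₀ a₁).γ n (gOfRecord₁₃ F N (theta13OfThm1CCMW F N j γ ε₀ ε₂₉ B₃ B₃' a₀ a₁) p) → ∀ m, m < n →
      (theta13OfThm1CCMW F N j γ ε₀ ε₂₉ B₃ B₃' a₀ a₁).s2.cR * epsOfRecord (theta13OfThm1CCMW F N j γ ε₀ ε₂₉ B₃ B₃' a₀ a₁).ν (gOfRecord₁₃ F N (theta13OfThm1CCMW F N j γ ε₀ ε₂₉ B₃ B₃' a₀ a₁) p) m ≤ 2 * ((theta13OfThm1CCMW F N j γ ε₀ ε₂₉ B₃ B₃' a₀ a₁).s2.cR * epsOfRecord (theta13OfThm1CCMW F N j γ ε₀ ε₂₉ B₃ B₃' a₀ a₁).ν (gOfRecord₁₃ F N (theta13OfThm1CCMW F N j γ ε₀ ε₂₉ B₃ B₃' a₀ a₁) p) (m + 1)))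
    (hcompRev : ∀ (p : B12.RunParams) (n : ℕ), n ≤ p.K → Step.InInterval (theta13OfThm1CCMW F N j γ ε₀ ε₂₉ B₃ B₃' a₀ a₁).γ n (gOfRecord₁₃ F N (theta13OfThm1CCMW F N j γ ε₀ ε₂₉ B₃ B₃' a₀ a₁) p) → ∀ m, m < n →
      (theta13OfThm1CCMW F N j γ ε₀ ε₂₉ B₃ B₃' a₀ a₁).s2.cR * epsOfRecord (theta13OfThm1CCMW F N j γ ε₀ ε₂₉ B₃ B₃' a₀ a₁).ν (gOfRecord₁₃ F N (theta13OfThm1CCMW F N j γ ε₀ ε₂₉ B₃ B₃' a₀ a₁) p) (m + 1) ≤ 2 * ((theta13OfThm1CCMW F N j γ ε₀ ε₂₉ B₃ B₃' a₀ a₁).s2.cR * epsOfRecord (theta13OfThm1CCMW F N j γ ε₀ ε₂₉ B₃ B₃' a₀ a₁).ν (gOfRecord₁₃ F N (theta13OfThm1CCMW F N j γ ε₀ ε₂₉ B₃ B₃' a₀ a₁) p) m)) :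
    ∀ (p : B12.RunParams) (n : ℕ), n ≤ p.K → Step.InInterval (theta13OfThm1CCMW F N j γ ε₀ ε₂₉ B₃ B₃' a₀ a₁).γ n (gOfRecord₁₃ F N (theta13OfThm1CCMW F N j γ ε₀ ε₂₉ B₃ B₃' a₀ a₁) p) →
      BgProvisoΛ F N p.K (settingOfRecord₁₃ F N (theta13OfThm1CCMW F N j γ ε₀ ε₂₉ B₃ B₃' a₀ a₁) p) ((theta13OfThm1CCMW F N j γ ε₀ ε₂₉ B₃ B₃' a₀ a₁).Rz p.K) (theta13OfThm1CCMW F N j γ ε₀ ε₂₉ B₃ B₃' a₀ a₁).τ9.M n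
        (suppOfRecord₁₃SepCoP F N (theta13OfThm1CCMW F N j γ ε₀ ε₂₉ B₃ B₃' a₀ a₁) p n) (UbgOfRecord₁₃CoP F N (theta13OfThm1CCMW F N j γ ε₀ ε₂₉ B₃ B₃' a₀ a₁) p n) :=
  bgProvisoΛ_theta13OfThm1CCMW_of_thm1RegSepCoP7MGB_of_thm1GaugeGB_of_hseam_of_hjm hγ0 hγ hjm hε hε' hB hB' ha₀ ha₁ h15 h15G Ubg hbg hseam hadm
    (dataSmall7LamTopOf_of_dataSmall7PTop_of_powM (theta13OfThm1CCMW F N j γ ε₀ ε₂₉ B₃ B₃' a₀ a₁) (theta13OfThm1CCMW_τ9_M F N j γ ε₀ ε₂₉ B₃ B₃' a₀ a₁)) hcomp hcompRev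

/-- **§3c ★★★ ROW P11 `BgProvisoΛ` AT THE z-WITNESS `θ₁₅ᶜᶜᴹᵂᶻ(j; γ; Efl, logz)` ON EVERY WINDOW RUN FROM THE ᴮ SENTENCES AT PRINT'S (7) DATA CLAUSE — `hDat` DISCHARGED** (`…SocketsGB` §3b at `Dat := dataSmall7LamTopOf F N`,
`hDat := §2` with `τ9.M = L^j`): non-wrapping families `j + 1 ≤ F.m`, any guard met on the window prefixes, any background `(Ubg, bd)` with `hbg` ∧ `hseam`.  CONDITIONAL; nothing of Bałaban asserted.
[cite: Balaban1985Variational, (3),(6)–(7) p.278, Thm 1 (8)–(9) p.279, p.304 lines 1–2; Balaban1984PropagatorsII, (2.3) p.224; Balaban1985RegularSpaces, (1.3)–(1.6) p.77; Balaban1988Convergent, (2.28) p.259, (2.18) p.257, (2.5) p.255, Thm 1 p.262; Balaban1987RG1, (0.1) p.251, (1.12) p.262; Balaban1989LargeFieldI, (0.3) p.176] -/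
theorem bgProvisoΛ_theta13OfThm1CCMWZ_of_thm1RegSepCoP7MGB_of_thm1GaugeGB_of_hseam_of_hjm_lamTop (hγ0 : 0 < γ) (hγ : γ ≤ 1 / 2) (hjm : j + 1 ≤ F.m) (hε : 0 < ε₀) (hε' : 0 < ε₂₉) (hB : 0 ≤ B₃)
    (hB' : 0 ≤ B₃') (ha₀ : 0 < a₀) (ha₁ : 0 < a₁) {Adm : StepGuard F} {bd : BondDatum F}
    (h15 : VariationalThm1RegSepCoP7MGB F N Adm bd (dataSmall7LamTopOf F N) B₃ a₀ a₁) (h15G : VariationalThm1GaugeRegSepCoP7MGB F N (F.L ^ j) Adm bd (dataSmall7LamTopOf F N) B₃ B₃' a₀ a₁)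
    (Ubg : (p : B12.RunParams) → (n : ℕ) → SeqOfRecord F (theta13OfThm1CCMWZ F N j γ ε₀ ε₂₉ B₃ B₃' a₀ a₁ Efl logz).ν (theta13OfThm1CCMWZ F N j γ ε₀ ε₂₉ B₃ B₃' a₀ a₁ Efl logz).τ9.M (gOfRecord₁₃ F N (theta13OfThm1CCMWZ F N j γ ε₀ ε₂₉ B₃ B₃' a₀ a₁ Efl logz) p) p.K n → BgMap F N p.K)
    (hbg : ∀ (p : B12.RunParams) (n : ℕ) (s : SeqOfRecord F (theta13OfThm1CCMWZ F N j γ ε₀ ε₂₉ B₃ B₃' a₀ a₁ Efl logz).ν (theta13OfThm1CCMWZ F N j γ ε₀ ε₂₉ B₃ B₃' a₀ a₁ Efl logz).τ9.M (gOfRecord₁₃ F N (theta13OfThm1CCMWZ F N j γ ε₀ ε₂₉ B₃ B₃' a₀ a₁ Efl logz) p) p.K n) (W : MSField (F.P p.K) (SU N)),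
      IsMinimizerB (avOfRecord F N p.K) (regMSCoPOfRecord F N (theta13OfThm1CCMWZ F N j γ ε₀ ε₂₉ B₃ B₃' a₀ a₁ Efl logz).ν p.K n s.Ω) (bd p.K n s.Ω) W (Ubg p n s W) ∨ Ubg p n s W = 1)
    (hseam : ∀ (p : B12.RunParams) (n : ℕ), UbgOfRecord₁₃CoP F N (theta13OfThm1CCMWZ F N j γ ε₀ ε₂₉ B₃ B₃' a₀ a₁ Efl logz) p (n + 1) = Ubg p (n + 1))
    (hadm : ∀ (p : B12.RunParams) (n : ℕ), n ≤ p.K → Step.InInterval (theta13OfThm1CCMWZ F N j γ ε₀ ε₂₉ B₃ B₃' a₀ a₁ Efl logz).γ n (gOfRecord₁₃ F N (theta13OfThm1CCMWZ F N j γ ε₀ ε₂₉ B₃ B₃' a₀ a₁ Efl logz) p) →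
      ∀ s : SeqOfRecord F (theta13OfThm1CCMWZ F N j γ ε₀ ε₂₉ B₃ B₃' a₀ a₁ Efl logz).ν (theta13OfThm1CCMWZ F N j γ ε₀ ε₂₉ B₃ B₃' a₀ a₁ Efl logz).τ9.M (gOfRecord₁₃ F N (theta13OfThm1CCMWZ F N j γ ε₀ ε₂₉ B₃ B₃' a₀ a₁ Efl logz) p) p.K n, Adm (theta13OfThm1CCMWZ F N j γ ε₀ ε₂₉ B₃ B₃' a₀ a₁ Efl logz).ν (theta13OfThm1CCMWZ F N j γ ε₀ ε₂₉ B₃ B₃' a₀ a₁ Efl logz).τ9.M (gOfRecord₁₃ F N (theta13OfThm1CCMWZ F N j γ ε₀ ε₂₉ B₃ B₃' a₀ a₁ Efl logz) p) p.K n s)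
    (hcomp : ∀ (p : B12.RunParams) (n : ℕ), n ≤ p.K → Step.InInterval (theta13OfThm1CCMWZ F N j γ ε₀ ε₂₉ B₃ B₃' a₀ a₁ Efl logz).γ n (gOfRecord₁₃ F N (theta13OfThm1CCMWZ F N j γ ε₀ ε₂₉ B₃ B₃' a₀ a₁ Efl logz) p) → ∀ m, m < n →
      (theta13OfThm1CCMWZ F N j γ ε₀ ε₂₉ B₃ B₃' a₀ a₁ Efl logz).s2.cR * epsOfRecord (theta13OfThm1CCMWZ F N j γ ε₀ ε₂₉ B₃ B₃' a₀ a₁ Efl logz).ν (gOfRecord₁₃ F N (theta13OfThm1CCMWZ F N j γ ε₀ ε₂₉ B₃ B₃' a₀ a₁ Efl logz) p) m ≤ 2 * ((theta13OfThm1CCMWZ F N j γ ε₀ ε₂₉ B₃ B₃' a₀ a₁ Efl logz).s2.cR * epsOfRecord (theta13OfThm1CCMWZ F N j γ ε₀ ε₂₉ B₃ B₃' a₀ a₁ Efl logz).ν (gOfRecord₁₃ F N (theta13OfThm1CCMWZ F N j γ ε₀ ε₂₉ B₃ B₃' a₀ a₁ Efl logz) p) (m + 1)))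
    (hcompRev : ∀ (p : B12.RunParams) (n : ℕ), n ≤ p.K → Step.InInterval (theta13OfThm1CCMWZ F N j γ ε₀ ε₂₉ B₃ B₃' a₀ a₁ Efl logz).γ n (gOfRecord₁₃ F N (theta13OfThm1CCMWZ F N j γ ε₀ ε₂₉ B₃ B₃' a₀ a₁ Efl logz) p) → ∀ m, m < n →
      (theta13OfThm1CCMWZ F N j γ ε₀ ε₂₉ B₃ B₃' a₀ a₁ Efl logz).s2.cR * epsOfRecord (theta13OfThm1CCMWZ F N j γ ε₀ ε₂₉ B₃ B₃' a₀ a₁ Efl logz).ν (gOfRecord₁₃ F N (theta13OfThm1CCMWZ F N j γ ε₀ ε₂₉ B₃ B₃' a₀ a₁ Efl logz) p) (m + 1) ≤ 2 * ((theta13OfThm1CCMWZ F N j γ ε₀ ε₂₉ B₃ B₃' a₀ a₁ Efl logz).s2.cR * epsOfRecord (theta13OfThm1CCMWZ F N j γ ε₀ ε₂₉ B₃ B₃' a₀ a₁ Efl logz).ν (gOfRecord₁₃ F N (theta13OfThm1CCMWZ F N j γ ε₀ ε₂₉ B₃ B₃' a₀ a₁ Efl logz) p) m)) :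
    ∀ (p : B12.RunParams) (n : ℕ), n ≤ p.K → Step.InInterval (theta13OfThm1CCMWZ F N j γ ε₀ ε₂₉ B₃ B₃' a₀ a₁ Efl logz).γ n (gOfRecord₁₃ F N (theta13OfThm1CCMWZ F N j γ ε₀ ε₂₉ B₃ B₃' a₀ a₁ Efl logz) p) →
      BgProvisoΛ F N p.K (settingOfRecord₁₃ F N (theta13OfThm1CCMWZ F N j γ ε₀ ε₂₉ B₃ B₃' a₀ a₁ Efl logz) p) ((theta13OfThm1CCMWZ F N j γ ε₀ ε₂₉ B₃ B₃' a₀ a₁ Efl logz).Rz p.K) (theta13OfThm1CCMWZ F N j γ ε₀ ε₂₉ B₃ B₃' a₀ a₁ Efl logz).τ9.M n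
        (suppOfRecord₁₃SepCoP F N (theta13OfThm1CCMWZ F N j γ ε₀ ε₂₉ B₃ B₃' a₀ a₁ Efl logz) p n) (UbgOfRecord₁₃CoP F N (theta13OfThm1CCMWZ F N j γ ε₀ ε₂₉ B₃ B₃' a₀ a₁ Efl logz) p n) :=
  bgProvisoΛ_theta13OfThm1CCMWZ_of_thm1RegSepCoP7MGB_of_thm1GaugeGB_of_hseam_of_hjm hγ0 hγ hjm hε hε' hB hB' ha₀ ha₁ h15 h15G Ubg hbg hseam hadm
    (dataSmall7LamTopOf_of_dataSmall7PTop_of_powM (theta13OfThm1CCMWZ F N j γ ε₀ ε₂₉ B₃ B₃' a₀ a₁ Efl logz) (theta13OfThm1CCMWZ_τ9_M F N j γ ε₀ ε₂₉ B₃ B₃' a₀ a₁ Efl logz)) hcomp hcompRev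

end AtPrint

end Summit.QuantumFields.YangMills.Theorems.BalabanUVNodesN11BgRowGaugeSocketsGBPrint

end
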